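import Literature.NumberTheory.Sieve.AletheiaZomleferFukshanskyGarcia2020Applications
import Literature.NumberTheory.Sieve.BatemanHornProofs
import HarnessLib

/-!
# Discharge of `polyRootCountMod_quadratic_odd` (AZFG 2020, §6.5): `ω_f(p)` for a quadratic `f` and an odd prime `p`

Topic `Literature/NumberTheory/Sieve`. A sibling proof file of
`AletheiaZomleferFukshanskyGarcia2020Applications.lean` (S. L. Aletheia-Zomlefer, L. Fukshansky,
S. R. Garcia, *The Bateman–Horn conjecture: heuristics, history, and applications*, Expo. Math. 38
(2020) = arXiv:1807.08899; locators are those of arXiv v4, as in the statement file), next to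
`AletheiaZomleferFukshanskyGarcia2020ApplicationsProofs.lean` (the §7.2 discharges); this one needs
the root-count-in-`ℤ/p` lemma of `BatemanHornProofs.lean`. Everything here is PROVED (no named
facts, no `sorry`).

* `Literature.NumberTheory.Sieve.polyRootCountMod_quadratic_odd_holds` — the named fact
  `Literature.NumberTheory.Sieve.polyRootCountMod_quadratic_odd`, i.e. the two displays of §6.5
  for `ω_f(p)`, `p` odd (between (6.5.2) and (6.5.3)): for `f(t) = at² + bt + c` with
  `gcd(a, b, c) = 1` and an odd prime `p`, `ω_f(p) = 0` or `1` according as `p ∣ b` or not when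
  `p ∣ a`, and `ω_f(p) = 1 + (Δ/p)` with `Δ = b² − 4ac` when `p ∤ a`.

## Proof (the source's, made explicit)

`ω_f(p)` is the number of roots of `f mod p` in `ℤ/p` (`polyRootCountMod_single_eq_card_zmod`,
`Literature/NumberTheory/Sieve/BatemanHornProofs.lean`).

* `p ∣ a`: "`f(t) ≡ bt + c (mod p)`" is linear; if also `p ∣ b` then `p ∤ c` ("since
  `gcd(a, b, c) = 1`") and there is no root, otherwise the unique root is `t ≡ −c/b`.
* `p ∤ a`: by the "completing the square" identity `4a(at² + bt + c) = (2at + b)² − (b² − 4ac)`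
  of §6.4, "`f(t) ≡ 0 (mod p) ⟺ (2at + b)² ≡ Δ (mod p)`", and since `t ↦ 2at + b` permutes `ℤ/p`
  (`p` odd, `p ∤ a`) the roots of `f` correspond bijectively to the square roots of `Δ` in `ℤ/p`
  (`card_filter_quadratic_eq_card_sqrts`), whose number is `1 + (Δ/p)` (Mathlib's
  `legendreSym.card_sqrts`); at a prime the Legendre symbol is the Jacobi symbol `jacobiSym Δ p`
  of the statement (Mathlib's `jacobiSym.legendreSym.to_jacobiSym`).

## References

* S. L. Aletheia-Zomlefer, L. Fukshansky, S. R. Garcia, *The Bateman–Horn conjecture: heuristics,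
  history, and applications*, Expo. Math. 38 (2020) 430–479, arXiv:1807.08899, §6.4 (the
  "completing the square" identity) and §6.5 (the two displays for `ω_f(p)`, `p` odd, between
  (6.5.2) and (6.5.3)). [AletheiaZomleferFukshanskyGarcia2020]
-/

open Finset Polynomial

namespace Literature.NumberTheory.Sieve

/-- Completing the square in `ℤ/p`, `p` an odd prime, `a ≠ 0`: `x ↦ 2ax + b` is a bijection from
the roots of `ax² + bx + c` onto the square roots of `b² − 4ac`
(`4a(ax² + bx + c) = (2ax + b)² − (b² − 4ac)`).
[cite: AletheiaZomleferFukshanskyGarcia2020, §6.4 (the "completing the square" identity) and §6.5] -/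
theorem card_filter_quadratic_eq_card_sqrts {p : ℕ} [Fact p.Prime] (hp2 : p ≠ 2)
    {a : ZMod p} (ha : a ≠ 0) (b c : ZMod p) :
    #(univ.filter fun x : ZMod p ↦ a * x ^ 2 + b * x + c = 0) =
      #(univ.filter fun y : ZMod p ↦ y ^ 2 = b ^ 2 - 4 * a * c) := by
  have h2 : (2 : ZMod p) ≠ 0 := by
    intro h
    have h' : ((2 : ℕ) : ZMod p) = 0 := by exact_mod_cast h
    rw [ZMod.natCast_eq_zero_iff] at h'
    exact hp2 ((Nat.prime_dvd_prime_iff_eq (Fact.out : p.Prime) Nat.prime_two).mp h')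
  set e : ZMod p := (2 * a)⁻¹ with he
  have h2ae : 2 * a * e = 1 := mul_inv_cancel₀ (mul_ne_zero h2 ha)
  refine Finset.card_nbij' (fun x ↦ 2 * a * x + b) (fun y ↦ (y - b) * e) ?_ ?_ ?_ ?_
  · intro x hx
    simp only [mem_coe, mem_filter, mem_univ, true_and] at hx ⊢
    linear_combination 4 * a * hx
  · intro y hy
    simp only [mem_coe, mem_filter, mem_univ, true_and] at hy ⊢
    linear_combination a * e ^ 2 * hy + (-(b * e * y) + b ^ 2 * e - c * (2 * a * e + 1)) * h2ae
  · intro x _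
    simp only
    linear_combination x * h2ae
  · intro y _
    simp only
    linear_combination (y - b) * h2ae

/-- **§6.5 discharged** (`polyRootCountMod_quadratic_odd`; the two displays for `ω_f(p)`, `p` odd,
between (6.5.2) and (6.5.3)): for `f(t) = at² + bt + c` with `gcd(a, b, c) = 1` and an odd prime
`p`, `ω_f(p) = 0` or `1` according as `p ∣ b` or not if `p ∣ a`, and `ω_f(p) = 1 + (Δ/p)`,
`Δ = b² − 4ac`, if `p ∤ a` (roots counted in `ℤ/p`; linear case, resp. completing the square and
Mathlib's count `legendreSym.card_sqrts` of square roots). (The hypothesis `0 < a` of the fact is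
not used.) [cite: AletheiaZomleferFukshanskyGarcia2020, §6.5 (displays for ω_f(p), p odd, before (6.5.3))] -/
theorem polyRootCountMod_quadratic_odd_holds : polyRootCountMod_quadratic_odd := by
  intro a b c _ hgcd p hp hp2
  haveI := Fact.mk hp
  have hp2' : p ≠ 2 := by omega
  have hdvd : ∀ z : ℤ, (p : ℤ) ∣ z ↔ (z : ZMod p) = 0 := fun z ↦
    (ZMod.intCast_zmod_eq_zero_iff_dvd z p).symm
  rw [polyRootCountMod_single_eq_card_zmod]
  have hset : (univ.filter fun x : ZMod p ↦
      ((C a * X ^ 2 + C b * X + C c).map (Int.castRingHom (ZMod p))).eval x = 0) =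
      univ.filter fun x : ZMod p ↦ (a : ZMod p) * x ^ 2 + (b : ZMod p) * x + (c : ZMod p) = 0 := by
    ext x
    simp
  rw [hset]
  by_cases hpa : (p : ℤ) ∣ a
  · rw [if_pos hpa]
    have ha0 : (a : ZMod p) = 0 := (hdvd a).mp hpa
    by_cases hpb : (p : ℤ) ∣ b
    · -- `f ≡ c (mod p)` with `p ∤ c`: no roots
      rw [if_pos hpb]
      have hb0 : (b : ZMod p) = 0 := (hdvd b).mp hpb
      have hc0 : (c : ZMod p) ≠ 0 := by
        intro hc
        have h1 : (p : ℤ) ∣ (Int.gcd (Int.gcd a b) c : ℤ) :=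
          Int.dvd_coe_gcd (Int.dvd_coe_gcd hpa hpb) ((hdvd c).mpr hc)
        rw [hgcd, Nat.cast_one] at h1
        have := Int.eq_one_of_dvd_one (Int.natCast_nonneg p) h1
        omega
      have hempty : (univ.filter fun x : ZMod p ↦
          (a : ZMod p) * x ^ 2 + (b : ZMod p) * x + (c : ZMod p) = 0) = ∅ := by
        refine filter_eq_empty_iff.mpr fun x _ h ↦ hc0 ?_
        simpa [ha0, hb0] using h
      rw [hempty, card_empty, Nat.cast_zero]
    · -- `f ≡ bt + c (mod p)` with `p ∤ b`: the unique root `-c/b`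
      rw [if_neg hpb]
      have hb0 : (b : ZMod p) ≠ 0 := fun h ↦ hpb ((hdvd b).mpr h)
      have hbinv : (b : ZMod p) * (b : ZMod p)⁻¹ = 1 := mul_inv_cancel₀ hb0
      have hsingle : (univ.filter fun x : ZMod p ↦
          (a : ZMod p) * x ^ 2 + (b : ZMod p) * x + (c : ZMod p) = 0) =
          {-(c : ZMod p) * (b : ZMod p)⁻¹} := by
        ext x
        simp only [mem_filter, mem_univ, true_and, mem_singleton, ha0, zero_mul, zero_add]
        constructor
        · intro h
          linear_combination (b : ZMod p)⁻¹ * h - x * hbinv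
        · rintro rfl
          linear_combination -(c : ZMod p) * hbinv
      rw [hsingle, card_singleton, Nat.cast_one]
  · -- `p ∤ a`: complete the square and count square roots of `Δ`
    rw [if_neg hpa]
    have ha0 : (a : ZMod p) ≠ 0 := fun h ↦ hpa ((hdvd a).mpr h)
    rw [card_filter_quadratic_eq_card_sqrts hp2' ha0, add_comm,
      ← jacobiSym.legendreSym.to_jacobiSym, ← legendreSym.card_sqrts p hp2' (b ^ 2 - 4 * a * c)]
    congr 2
    ext y
    simp

end Literature.NumberTheory.Sieve
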